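import Summits.QuantumFields.YangMills.Theorems.ConvexGribovBodyNonSimplyConnectedLatticeGapWeakMixingFunnel
import Literature.Probability.LatticeModels.GibbsSpecificationDLRProofs
import HarnessLib

/-!
# Weak mixing on cubes implies uniqueness of the gauge-invariant infinite-volume state
# (stub `stub_gaugeInvariantUniqueness_of_boxInfluenceDecay` (UQ) of crux stmt-QuantumFields-16405,
# route `ConvexGribovBody`, line `Sketch` v6)

For the lattice Yang–Mills specification `γ = ymSpecification ρ β` on `ℤ⁴` (compact metrisable gauge group `G`,
continuous representation `ρ`): if for every gauge-invariant local observable `A` the boundary influence on the cubes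
of links `Λ_L = [−L, L]⁴ × univ` decays, `|γ_{Λ_L}(A | η) − γ_{Λ_L}(A | η')| ≤ C_A e^{−mL}` with `m > 0`, then any two
DLR states `μ, ν ∈ 𝒢(γ)` agree on every gauge-invariant local observable. Proof (Georgii 2011 §8.2 / Friedli–Velenik
2017 Lemma 6.30 pattern): by the DLR equation for observables (`IsGibbsMeasure.integral_integral_eq`),
`∫ A dμ = ∫ γ_{Λ_L}(A | η) dμ(η)`, so for a fixed reference exterior datum `η₀`,
`|∫ A dμ − γ_{Λ_L}(A | η₀)| = |∫ (γ_{Λ_L}(A | η) − γ_{Λ_L}(A | η₀)) dμ(η)| ≤ C_A e^{−mL}`; likewise for `ν`, hence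
`|∫ A dμ − ∫ A dν| ≤ 2 C_A e^{−mL} → 0` as `L → ∞`.
-/

set_option autoImplicit false

noncomputable section

open MeasureTheory Filter Topology
open Literature.Probability.LatticeModels
open Literature.MathematicalPhysics.QuantumLattice
open Literature.MathematicalPhysics.QuantumFieldTheory (isSpecification_ymSpecification_of_t2Space)

namespace Summit.QuantumFields.YangMills.Theorems.NonSimplyConnectedLatticeGap

section Helpers

variable {G : Type} [Group G] [TopologicalSpace G] [IsTopologicalGroup G] [CompactSpace G]
  [MeasurableSpace G] [BorelSpace G] [SecondCountableTopology G] [T2Space G]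
  {N : ℕ} (ρ : G →* Matrix (Fin N) (Fin N) ℂ)

/-- **DLR state vs. one kernel mean.** For a DLR state `κ` of `ymSpecification ρ β`, a bounded measurable observable
`F`, a finite link set `Λ` and a reference exterior datum `η₀`: if all kernel means `γ_Λ(F | η)` are within `Δ` of
`γ_Λ(F | η₀)`, then so is `∫ F dκ`, because `∫ F dκ = ∫ γ_Λ(F | η) dκ(η)` (DLR equation for observables,
`IsGibbsMeasure.integral_integral_eq`) and `κ` is a probability measure. -/
theorem abs_integral_sub_boxMean_le_of_isGibbsMeasure (hρ : Continuous ρ) (β : ℝ)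
    {κ : Measure (LGConfig 4 G)} (hκ : IsGibbsMeasure (ymSpecification ρ β) κ) (Λ : Finset (ZdEdge 4))
    {F : LGConfig 4 G → ℝ} (hFm : Measurable F) {C : ℝ} (hC : ∀ U, |F U| ≤ C) (η₀ : LGConfig 4 G) {Δ : ℝ}
    (hΔ : ∀ η : LGConfig 4 G,
      |(∫ U, F U ∂(ymSpecification ρ β Λ η)) - ∫ U, F U ∂(ymSpecification ρ β Λ η₀)| ≤ Δ) :
    |(∫ U, F U ∂κ) - ∫ U, F U ∂(ymSpecification ρ β Λ η₀)| ≤ Δ := by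
  have hγ := isSpecification_ymSpecification_of_t2Space (d := 4) ρ hρ β
  haveI := hκ.isProbabilityMeasure
  -- the kernel mean `η ↦ γ_Λ(F | η)` is measurable and bounded by `C`
  have hgm : Measurable fun η : LGConfig 4 G => ∫ U, F U ∂(ymSpecification ρ β Λ η) := by
    -- adapted from `Literature.Probability.LatticeModels.DobrushinShlosman.measurable_windowAvg'`
    let k : ProbabilityTheory.Kernel (LGConfig 4 G) (LGConfig 4 G) :=
      ⟨ymSpecification ρ β Λ, hγ.measurable_fun Λ⟩
    exact (hFm.stronglyMeasurable.integral_kernel (κ := k)).measurable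
  have hgb : ∀ η : LGConfig 4 G, |∫ U, F U ∂(ymSpecification ρ β Λ η)| ≤ C := fun η =>
    abs_integral_ymSpecification_le ρ hρ β Λ hC η
  -- DLR equation for observables
  have hDLR : ∫ η, ∫ U, F U ∂(ymSpecification ρ β Λ η) ∂κ = ∫ U, F U ∂κ :=
    hκ.integral_integral_eq hγ Λ (integrable_of_abs_le hFm hC)
  have hsub : (∫ η, ∫ U, F U ∂(ymSpecification ρ β Λ η) ∂κ) - ∫ U, F U ∂(ymSpecification ρ β Λ η₀) =
      ∫ η, ((∫ U, F U ∂(ymSpecification ρ β Λ η)) - ∫ U, F U ∂(ymSpecification ρ β Λ η₀)) ∂κ :=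
    (integral_sub_const_of_abs_le hgm hgb _).symm
  rw [← hDLR, hsub]
  exact Literature.MathematicalPhysics.QuantumLattice.abs_integral_le_of_abs_le fun η => hΔ η

/-- **Weak mixing on cubes for one observable ⇒ all DLR states agree on it.** If the cube influence of the bounded
measurable observable `A` decays, `|γ_{Λ_L}(A | η) − γ_{Λ_L}(A | η')| ≤ K e^{−mL}` for all `L` and all exterior data,
with `m > 0`, then `∫ A dμ = ∫ A dν` for any two DLR states `μ, ν` of `ymSpecification ρ β`: with the reference
exterior datum `η₀ = 1`, `|∫ A dμ − γ_{Λ_L}(A | 1)| ≤ K e^{−mL}` and `|∫ A dν − γ_{Λ_L}(A | 1)| ≤ K e^{−mL}`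
(`abs_integral_sub_boxMean_le_of_isGibbsMeasure`), so `|∫ A dμ − ∫ A dν| ≤ 2 K e^{−mL}` for every `L`, and the
right-hand side tends to `0` (Georgii 2011 §8.2). -/
theorem integral_eq_integral_of_boxInfluenceDecay (hρ : Continuous ρ) (β : ℝ) {m : ℝ} (hm : 0 < m)
    (A : LocalGaugeObservable 4 G) {K : ℝ}
    (hK : ∀ (L : ℕ) (η η' : LGConfig 4 G),
      |(∫ U, A.F U ∂(ymSpecification ρ β ((Fintype.piFinset fun _ : Fin 4 =>
          Finset.Icc (-((L : ℕ) : ℤ)) ((L : ℕ) : ℤ)) ×ˢ (Finset.univ : Finset (Fin 4))) η)) -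
        ∫ U, A.F U ∂(ymSpecification ρ β ((Fintype.piFinset fun _ : Fin 4 =>
          Finset.Icc (-((L : ℕ) : ℤ)) ((L : ℕ) : ℤ)) ×ˢ (Finset.univ : Finset (Fin 4))) η')| ≤
        K * Real.exp (-(m * L)))
    {μ ν : Measure (LGConfig 4 G)} (hμ : IsGibbsMeasure (ymSpecification ρ β) μ)
    (hν : IsGibbsMeasure (ymSpecification ρ β) ν) :
    ∫ U, A.F U ∂μ = ∫ U, A.F U ∂ν := by
  obtain ⟨CA, hCA⟩ := A.bounded
  -- two reals within `Δ` of a third are within `2Δ` of each other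
  have key : ∀ a b c Δ : ℝ, |a - c| ≤ Δ → |b - c| ≤ Δ → |a - b| ≤ 2 * Δ := by
    intro a b c Δ h1 h2
    rw [abs_le] at h1 h2 ⊢
    constructor <;> linarith [h1.1, h1.2, h2.1, h2.2]
  -- for every radius `L`: `|∫ A dμ − ∫ A dν| ≤ 2 K e^{−mL}` (reference exterior datum `η₀ = 1`)
  have hL : ∀ L : ℕ, |(∫ U, A.F U ∂μ) - ∫ U, A.F U ∂ν| ≤ 2 * (K * Real.exp (-(m * L))) := by
    intro L
    have h1 := abs_integral_sub_boxMean_le_of_isGibbsMeasure ρ hρ β hμ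
      ((Fintype.piFinset fun _ : Fin 4 => Finset.Icc (-((L : ℕ) : ℤ)) ((L : ℕ) : ℤ)) ×ˢ
        (Finset.univ : Finset (Fin 4))) A.measurable hCA 1 (fun η => hK L η 1)
    have h2 := abs_integral_sub_boxMean_le_of_isGibbsMeasure ρ hρ β hν
      ((Fintype.piFinset fun _ : Fin 4 => Finset.Icc (-((L : ℕ) : ℤ)) ((L : ℕ) : ℤ)) ×ˢ
        (Finset.univ : Finset (Fin 4))) A.measurable hCA 1 (fun η => hK L η 1)
    exact key _ _ _ _ h1 h2
  -- let `L → ∞`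
  have hlim : Tendsto (fun L : ℕ => 2 * (K * Real.exp (-(m * L)))) atTop (𝓝 0) := by
    have h1 : Tendsto (fun L : ℕ => m * (L : ℝ)) atTop atTop :=
      Tendsto.const_mul_atTop hm tendsto_natCast_atTop_atTop
    have h2 : Tendsto (fun L : ℕ => Real.exp (-(m * (L : ℝ)))) atTop (𝓝 0) :=
      Real.tendsto_exp_neg_atTop_nhds_zero.comp h1
    have h3 := (h2.const_mul K).const_mul 2
    rwa [mul_zero, mul_zero] at h3
  have h0 : |(∫ U, A.F U ∂μ) - ∫ U, A.F U ∂ν| ≤ 0 := ge_of_tendsto' hlim hL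
  exact sub_eq_zero.1 (abs_nonpos_iff.1 h0)

end Helpers

/-- **Weak mixing on cubes ⇒ uniqueness of the gauge-invariant infinite-volume state** (registered stub
`stub_gaugeInvariantUniqueness_of_boxInfluenceDecay` (UQ) of the skeleton `Cruxes/NonSimplyConnectedLatticeGap/Lines/Sketch.lean`
v6 of item stmt-QuantumFields-16405): under per-observable exponential decay (rate `m > 0`) of the cube influence of
`ymSpecification ρ β`, any two DLR states agree on every gauge-invariant local observable `A`
(`integral_eq_integral_of_boxInfluenceDecay` applied to the constant `C_A` of `A`). -/
theorem stub_gaugeInvariantUniqueness_of_boxInfluenceDecay : ∀ (G : Type) [Group G] [TopologicalSpace G] [IsTopologicalGroup G] [CompactSpace G] [MeasurableSpace G] [BorelSpace G] [SecondCountableTopology G] [T2Space G] (N : ℕ) (ρ : G →* Matrix (Fin N) (Fin N) ℂ), Continuous ρ → ∀ (β m : ℝ), 0 < m → (∀ A : Literature.MathematicalPhysics.QuantumLattice.LocalGaugeObservable 4 G, ∃ C : ℝ, ∀ (L : ℕ) (η η' : Literature.MathematicalPhysics.QuantumLattice.LGConfig 4 G), |(∫ U, A.F U ∂(Literature.MathematicalPhysics.QuantumLattice.ymSpecification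 ρ β ((Fintype.piFinset fun _ : Fin 4 => Finset.Icc (-((L : ℕ) : ℤ)) ((L : ℕ) : ℤ)) ×ˢ (Finset.univ : Finset (Fin 4))) η)) - ∫ U, A.F U ∂(Literature.MathematicalPhysics.QuantumLattice.ymSpecification ρ β ((Fintype.piFinset fun _ : Fin 4 => Finset.Icc (-((L : ℕ) : ℤ)) ((L : ℕ) : ℤ)) ×ˢ (Finset.univ : Finset (Fin 4))) η')| ≤ C * Real.exp (-(m * L))) → ∀ μ ν : MeasureTheory.Measure (Literature.MathematicalPhysics.QuantumLattice.LGConfig 4 G), μ ∈ Literature.MathematicalPhysics.QuantumLattice.ymGibbsMeasures (d := 4) ρ β → ν ∈ Literature.MathematicalPhysics.QuantumLattice.ymGibbsMeasures (d := 4) ρ β → ∀ A : Literature.MathematicalPhysics.QuantumLattice.LocalGaugeObservable 4 G, ∫ U, A.F U ∂μ = ∫ U, A.F U ∂ν := by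
  intro G _ _ _ _ _ _ _ _ N ρ hρ β m hm hWM μ ν hμ hν A
  rcases hWM A with ⟨K, hK⟩
  exact integral_eq_integral_of_boxInfluenceDecay ρ hρ β hm A hK
    ((Literature.MathematicalPhysics.QuantumLattice.mem_ymGibbsMeasures_iff ρ β μ).1 hμ)
    ((Literature.MathematicalPhysics.QuantumLattice.mem_ymGibbsMeasures_iff ρ β ν).1 hν)

end Summit.QuantumFields.YangMills.Theorems.NonSimplyConnectedLatticeGap

end
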